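import Literature.Geometry.Manifold.PreferredChart
import Literature.Geometry.Manifold.OpenSubmanifoldMFDeriv
import Literature.Topology.FourManifolds.ClosedBallProofs
import Literature.Geometry.Symplectic.GromovMcDuffChartFormProofs
import Literature.Topology.FourManifolds.HomotopyS4FoldMapProofs
import Literature.Topology.FourManifolds.HomotopyS4CompactProofs
import Literature.Topology.FourManifolds.HomotopyS4OrientableProofs
import Literature.Geometry.Symplectic.GromovMcDuffTwistedSphereProofs
import Literature.Geometry.Symplectic.GromovR4StdModel
import Summits.SmoothPoincare4.SmoothPoincare4.Theorems.PICReduction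
import Summits.SmoothPoincare4.SmoothPoincare4.Theorems.SymplecticOrigamiFoldedSphereFoldExistenceFactSanity
import HarnessLib

/-!
# `FoldedSphereFoldExistence`: the pole-immersion route to the upstream fact is SPC4-hard

Route `SmoothPoincare4/SymplecticOrigami`, support item `FoldedSphereFoldExistence`
(stmt-SmoothPoincare4-14076), which is CLOSED MODULO the named fact
`Literature.Topology.FourManifolds.eliashberg_foldMap_homotopySphere_four` (Eliashberg's
equidimensional folding theorem, instance "every smooth homotopy 4-sphere folds into `ℝ⁴` along a
coordinate 3-sphere"; `…FoldedSphereFoldExistence.lean`,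
`foldedSphereFoldExistence_of_eliashbergFoldMap`). The only reduction of that fact recorded in
the tree is `Literature.Topology.FourManifolds.eliashberg_foldMap_homotopySphere_four_of_poleImmersion`
(`HomotopyS4FoldMapProofs.lean`, §3–§4): the fact follows from

> `H`: every smooth homotopy 4-sphere `M` carries a chart `χ` of its maximal atlas centred at some
> `q` and a map `g : M → ℝ⁴`, a `C^∞` immersion on `M ∖ {q}`, equal to the inverted chart
> `χ / ‖χ‖²` near `q` (a "pole immersion"),

whose docstring presents `H` as "what Eliashberg's `h`-principle applied to the trivial folded
tangent bundle provides (and conversely …)". **This file proves that `H` implies the smooth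
4-dimensional Poincaré conjecture**, modulo the single deep fact
`Literature.Geometry.Symplectic.gromov_recognitionR4_relEnd` (Gromov 1985, §0.3.C;
McDuff–Salamon 2017, Rem. 4.5.2 (viii)) that route `SymplecticCap` rests on:

* `nonempty_diffeomorph_sphere_of_poleImmersion` — a homotopy 4-sphere with a pole immersion is
  diffeomorphic to `S⁴`: `g*ω₀` is a symplectic form on `M ∖ {q}` which near `q` is the pull-back
  of `ι*ω₀` by the chart, i.e. `(M ∖ {q}, g*ω₀)` is *standard at infinity*
  (`isSymplecticStandardNearPoint_pullback_of_immersion`, the immersion version of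
  `isSymplecticStandardNearPoint_pullback`); Gromov's recognition theorem in the tree's chart form
  (`nonempty_diffeomorph_sphere_of_recognitionR4_relEnd`: `M ∖ {q} ≅ ℝ⁴` rel the inverted chart,
  then the double of two discs) gives `M ≅ S⁴`. The chart-form facts are phrased with the
  PREFERRED chart at `q`; the arbitrary maximal-atlas chart `χ` of `H` is made preferred on the
  type synonym `WithPreferredChart M χ` (`Literature/Geometry/Manifold/PreferredChart.lean`: same
  maximal atlas, identity diffeomorphism `toOrig`), which is where the proof takes place.
* `smoothPoincare4_of_poleImmersion` — hence `H → SmoothPoincare4` (mod Gromov), `H` verbatim.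
* `poleImmersion_of_smoothPoincare4` — conversely and unconditionally `SmoothPoincare4 → H`: by
  the tree's proved chart form of Palais' disc theorem (`palais_puncturedSphere_chartForm_holds`)
  a puncture of a standard `M` has a diffeomorphism onto `ℝ⁴` equal to the inverted recentred
  chart near `p`; translate and restrict the chart (`trans_mem_maximalAtlas_of_contDiffOn`),
  extend the diffeomorphism by `0` at `p`.
* `poleImmersion_iff_smoothPoincare4` — so `H ↔ SmoothPoincare4` granted Gromov's theorem; and
  `poleImmersion_route_is_spc4_hard` — `H ⇒ SPC4 ∧ fact` (with `…FactSanity`'s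
  `eliashberg_foldMap_homotopySphere_four_of_smoothPoincare4`, SPC4 ⇒ fact).

## Meaning for the item and for the debt `eliashberg_foldMap_homotopySphere_four`

The fact is a theorem in print for EVERY homotopy 4-sphere (Gromov, PDR §2.1.3 (D); Eliashberg
1970): the formal datum exists (Cannas da Silva 2010, §4) and Eliashberg's two-sided fold surgery
produces a fold map whose fold IMAGE is an arbitrary immersed 3-sphere in `ℝ⁴`. A pole immersion
is much more: it makes one sheet an EMBEDDED round collar, so the pulled-back form is a filling
of the round contact `S³` standard near the boundary, and Gromov–McDuff rigidity applies. Hence,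
granted Gromov's theorem, an exotic homotopy 4-sphere carries Eliashberg's fold map but NO pole
immersion, and no proof of the fact can factor through `H` without proving SPC4. The same
objection disposes of "relative Smale–Hirsch on the fake ball `Δ = M ∖ e(B̊)` with the fold
collar prescribed": `(Δ, ∂Δ)` is not an open pair (a relative handle decomposition of the
compact `Δ` on its boundary collar has 4-handles), so the `h`-principle for immersions does not
apply, and a solution would again be a standard-near-the-boundary symplectic filling of `S³` by
`Δ`, forcing `Δ ≅ B⁴`. A discharge of the fact must formalise Eliashberg's folding theorem
itself (immersion theory of open manifolds on both sheets plus fold surgery), nothing less.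

## References

* M. Gromov, *Pseudo holomorphic curves in symplectic manifolds*, Invent. Math. 82 (1985),
  §0.3.C [Gromov1985]; D. McDuff, D. Salamon, *Introduction to Symplectic Topology*, 3rd ed.
  (2017), Rem. 4.5.2 (viii) [McDuffSalamon2017].
* M. Gromov, *Partial Differential Relations* (1986), §2.1.3 (D) [Gromov1986]; Y. Eliashberg,
  *On singularities of folding type*, Math. USSR Izv. 4 (1970) [Eliashberg1970].
* A. Cannas da Silva, *Fold-forms for four-folds*, J. Symplectic Geom. 8 (2010), §4
  [Cannasdasilva2010].
* R. S. Palais, *Extending diffeomorphisms*, Proc. AMS 11 (1960) 274–277, Thm. B [Palais1960].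
-/

noncomputable section

open Set Function Metric TopologicalSpace
open scoped Manifold ContDiff Topology ContinuousMap
open Literature.Geometry.Kaehler Literature.Geometry.Symplectic Literature.Topology.FourManifolds
open Literature.Geometry.Manifold

-- `Summit.SmoothPoincare4.SmoothPoincare4.…` is the tree's fixed summit/problem namespace (D-0017).
set_option linter.dupNamespace false

namespace Summit.SmoothPoincare4.SmoothPoincare4.Theorems.FoldedSphereFoldExistence

/-- Local notation for the model space `ℝ⁴`. -/
local notation "E4" => EuclideanSpace ℝ (Fin 4)

/-- Local notation for the round `4`-sphere. -/
local notation "𝕊⁴" => (Metric.sphere (0 : EuclideanSpace ℝ (Fin 5)) 1)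

/-! ### §1 An immersion standard at the pole pulls `ω₀` back to a standard end -/

section Immersion

variable {M : Type*} [TopologicalSpace M] [T2Space M] [ChartedSpace E4 M] [IsManifold (𝓡 4) ∞ M]

/-- **Nondegeneracy of `G*ω₀` for an immersion.** If `dG_x` is injective then, `ℝ⁴` being
`4`-dimensional, it is a linear isomorphism of the tangent space onto `ℝ⁴`, and `ω₀` is
nondegenerate (`stdSymplecticMForm_nondegenerate`). [folklore] -/
theorem stdSymplecticMForm_pullback_nondegenerate_of_injective
    {N : Type*} [TopologicalSpace N] [ChartedSpace E4 N] {G : N → E4} (x : N)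
    (hG : Injective (mfderiv (𝓡 4) (𝓡 4) G x)) (v : TangentSpace (𝓡 4) x) (hv : v ≠ 0) :
    ∃ w : TangentSpace (𝓡 4) x, stdSymplecticMForm.pullback (𝓡 4) G x ![v, w] ≠ 0 := by
  set L : E4 →L[ℝ] E4 := mfderiv (𝓡 4) (𝓡 4) G x with hL
  have hLs : Surjective L := by
    have h := LinearMap.surjective_of_injective (f := (L : E4 →ₗ[ℝ] E4)) hG
    exact h
  have hLv : L v ≠ 0 := fun h0 => hv (hG (h0.trans (map_zero L).symm))
  obtain ⟨w', hw'⟩ := stdSymplecticMForm_nondegenerate (G x) (L v) hLv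
  obtain ⟨w, rfl⟩ := hLs w'
  refine ⟨w, ?_⟩
  rw [stdSymplecticMForm_pullback_apply]
  rwa [stdSymplecticMForm_apply] at hw'

/-- **An immersion of `M ∖ {p}` which is the inverted recentred chart near `p` pulls `ω₀` back
to a symplectic form standard near `p`** (any radius `ε > 0`): `G*ω₀` is smooth and closed
(`C^∞` pull-back of the closed form `ω₀`), nondegenerate (`dG` injective), and on the punctured
chart source `dG_x = Dι(e x − e p) ∘ De_x` (`hasMFDerivAt_inversion_extChartAt_sub`), which is
the end clause of `IsSymplecticStandardNearPoint` verbatim. This is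
`isSymplecticStandardNearPoint_pullback` (`GromovR4StdModel.lean`) with the diffeomorphism
weakened to an immersion. [cite: Gromov1985, §0.3.C] -/
theorem isSymplecticStandardNearPoint_pullback_of_immersion (p : M) {G : punctured p → E4}
    (hG : ContMDiff (𝓡 4) (𝓡 4) ∞ G) (hGi : ∀ x, Injective (mfderiv (𝓡 4) (𝓡 4) G x))
    (hGp : ∀ x : punctured p, x.1 ∈ (chartAt E4 p).source →
      G x = inversion (extChartAt (𝓡 4) p x.1 - extChartAt (𝓡 4) p p))
    {ε : ℝ} (hε : 0 < ε) :
    IsSymplecticStandardNearPoint p ε (stdSymplecticMForm.pullback (𝓡 4) G) := by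
  refine ⟨hε, isSmoothForm_stdSymplecticMForm_pullback hG,
    isClosedForm_stdSymplecticMForm_pullback hG,
    fun x v hv => stdSymplecticMForm_pullback_nondegenerate_of_injective x (hGi x) v hv, ?_⟩
  intro x hxs _hxb v w
  have hO : IsOpen {z : punctured p | z.1 ∈ (chartAt E4 p).source} :=
    continuous_subtype_val.isOpen_preimage _ (chartAt E4 p).open_source
  have hev : G =ᶠ[𝓝 x]
      fun z : punctured p => inversion (extChartAt (𝓡 4) p z.1 - extChartAt (𝓡 4) p p) :=
    Filter.eventuallyEq_of_mem (hO.mem_nhds hxs) fun z hz => hGp z hz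
  have hd := (hasMFDerivAt_inversion_extChartAt_sub p x hxs).congr_of_eventuallyEq hev
  rw [stdSymplecticMForm_pullback_apply, hd.mfderiv]
  rfl

end Immersion

/-! ### §2 A homotopy 4-sphere with a pole immersion is diffeomorphic to `S⁴` (mod Gromov) -/

section Pole

/-- **Pole immersions make the homotopy sphere standard** (modulo Gromov's recognition of
`(ℝ⁴, ω₀)` relative at infinity, tree fact `gromov_recognitionR4_relEnd`). Let `M` be a smooth
homotopy 4-sphere, `χ` a chart of its maximal atlas centred at `q`, and `g : M → ℝ⁴` a `C^∞`
immersion on `M ∖ {q}` equal to the inverted chart `χ / ‖χ‖²` near `q` (the hypothesis of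
`Literature.Topology.FourManifolds.eliashberg_foldMap_homotopySphere_four_of_poleImmersion`). Then
`M ≅ S⁴`: after making `χ` the preferred chart at `q` (`WithPreferredChart M χ`, same maximal
atlas), `g*ω₀` is a symplectic form on `M ∖ {q}` standard near `q`
(`isSymplecticStandardNearPoint_pullback_of_immersion`), so Gromov–McDuff
(`nonempty_diffeomorph_sphere_of_recognitionR4_relEnd`: `M ∖ {q} ≅ ℝ⁴` rel the inverted chart,
then the double of discs) gives `M ≅ S⁴`. Hence a pole immersion on an EXOTIC `M` cannot exist
(granted Gromov's theorem), although Eliashberg's fold map does: the pole-immersion hypothesis is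
SPC4-strength, not a reformulation of the Eliashberg instance.
[cite: Gromov1985, §0.3.C] [cite: McDuffSalamon2017, Rem. 4.5.2 (viii)] -/
theorem nonempty_diffeomorph_sphere_of_poleImmersion (hA : gromov_recognitionR4_relEnd)
    {M : Type} [TopologicalSpace M] [T2Space M] [SecondCountableTopology M] [ChartedSpace E4 M]
    [IsManifold (𝓡 4) ∞ M] (hM : M ≃ₕ 𝕊⁴) {q : M} {χ : OpenPartialHomeomorph M E4} {g : M → E4}
    (hχ : χ ∈ IsManifold.maximalAtlas (𝓡 4) ∞ M) (hq : q ∈ χ.source) (hχq : χ q = 0)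
    (hg : ∀ x, x ≠ q → ContMDiffAt (𝓡 4) (𝓡 4) ∞ g x)
    (hg' : ∀ x, x ≠ q → Injective (mfderiv (𝓡 4) (𝓡 4) g x))
    (hpole : ∀ x ∈ χ.source, x ≠ q → g x = (‖χ x‖ ^ 2)⁻¹ • χ x) :
    Nonempty (M ≃ₘ⟮𝓡 4, 𝓡 4⟯ 𝕊⁴) := by
  haveI : CompactSpace M := compactSpace_of_homotopyEquiv_sphere_four_holds M hM
  haveI : IsManifold (𝓡 4) ∞ (WithPreferredChart M χ) := WithPreferredChart.isManifold hχ
  -- the identity diffeomorphism and the copy of `q`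
  set D : WithPreferredChart M χ ≃ₘ⟮𝓡 4, 𝓡 4⟯ M := WithPreferredChart.toOrig hχ with hD
  set q' : WithPreferredChart M χ := (WithPreferredChart.equiv χ).symm q with hq'
  have hDq : ∀ x : WithPreferredChart M χ, D x = q ↔ x = q' := fun x => by
    constructor
    · intro h; exact (WithPreferredChart.equiv χ).injective h
    · intro h; rw [h]; rfl
  -- the homotopy sphere structure on the copy
  have hM' : WithPreferredChart M χ ≃ₕ 𝕊⁴ := hM
  obtain ⟨o'⟩ := isOrientable_of_homotopyEquiv_sphere_four_holds (WithPreferredChart M χ) hM'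
  set S' : HomotopySphere 4 := ⟨WithPreferredChart M χ, o', ⟨hM'⟩⟩ with hS'
  -- the immersion on the punctured copy
  set G : punctured q' → E4 := fun x => g (D x.1) with hG
  have hne : ∀ x : punctured q', D x.1 ≠ q := fun x h => (mem_punctured.1 x.2) ((hDq x.1).1 h)
  have hGs : ContMDiff (𝓡 4) (𝓡 4) ∞ G := by
    intro x
    have h1 : ContMDiffAt (𝓡 4) (𝓡 4) ∞ (fun y : WithPreferredChart M χ => g (D y)) x.1 :=
      (hg _ (hne x)).comp x.1 D.contMDiff.contMDiffAt
    exact h1.comp x (contMDiff_subtype_val (U := punctured q')).contMDiffAt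
  have hGi : ∀ x, Injective (mfderiv (𝓡 4) (𝓡 4) G x) := by
    intro x
    have hn : (∞ : WithTop ℕ∞) ≠ 0 := by simp
    have hgD : HasMFDerivAt (𝓡 4) (𝓡 4) g (D x.1) (mfderiv (𝓡 4) (𝓡 4) g (D x.1)) :=
      ((hg _ (hne x)).mdifferentiableAt hn).hasMFDerivAt
    have hDx : HasMFDerivAt (𝓡 4) (𝓡 4) D x.1 (mfderiv (𝓡 4) (𝓡 4) D x.1) :=
      ((D.mdifferentiable hn) x.1).hasMFDerivAt
    have hval := OpenSubmanifold.hasMFDerivAt_subtype_val (I := 𝓡 4) (U := punctured q') x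
    have hcomp : HasMFDerivAt (𝓡 4) (𝓡 4) G x
        (((mfderiv (𝓡 4) (𝓡 4) g (D x.1)).comp (mfderiv (𝓡 4) (𝓡 4) D x.1)).comp
          (ContinuousLinearMap.id ℝ E4)) :=
      (hgD.comp x.1 hDx).comp x hval
    have hB : Injective (mfderiv (𝓡 4) (𝓡 4) D x.1) := by
      have h := (D.mfderivToContinuousLinearEquiv hn x.1).injective
      rw [← ContinuousLinearEquiv.coe_coe, Diffeomorph.mfderivToContinuousLinearEquiv_coe] at h
      exact h
    rw [hcomp.mfderiv]
    intro v w hvw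
    have h1 : mfderiv (𝓡 4) (𝓡 4) g (D x.1) (mfderiv (𝓡 4) (𝓡 4) D x.1 v) =
        mfderiv (𝓡 4) (𝓡 4) g (D x.1) (mfderiv (𝓡 4) (𝓡 4) D x.1 w) := hvw
    exact hB (hg' _ (hne x) h1)
  -- near the pole `G` is the inverted (preferred!) chart
  have hGp : ∀ x : punctured q', x.1 ∈ (chartAt E4 q').source →
      G x = inversion (extChartAt (𝓡 4) q' x.1 - extChartAt (𝓡 4) q' q') := by
    intro x hx
    have hcq : chartAt E4 q' = χ := WithPreferredChart.chartAt_of_mem_source (x := q') hq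
    have heq : extChartAt (𝓡 4) q' = χ.extend (𝓡 4) :=
      WithPreferredChart.extChartAt_of_mem_source (x := q') (𝓡 4) hq
    rw [hcq] at hx
    have h1 : ∀ y, χ.extend (𝓡 4) y = χ y := fun y => by
      simp
    have h2 : χ q' = 0 := hχq
    rw [heq, h1, h1, h2, sub_zero]
    exact hpole _ hx (hne x)
  have hstd : IsSymplecticStandardNearPoint q' 1 (stdSymplecticMForm.pullback (𝓡 4) G) :=
    isSymplecticStandardNearPoint_pullback_of_immersion q' hGs hGi hGp one_pos
  obtain ⟨Φ⟩ := nonempty_diffeomorph_sphere_of_recognitionR4_relEnd hA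
    ⟨WithPreferredChart M χ, o', ⟨hM'⟩⟩ q' 1 _ hstd
  exact ⟨D.symm.trans Φ⟩

/-- **The pole-immersion hypothesis implies SPC4** (modulo `gromov_recognitionR4_relEnd`). The
hypothesis `H` is VERBATIM that of the tree's reduction
`Literature.Topology.FourManifolds.eliashberg_foldMap_homotopySphere_four_of_poleImmersion`
("every smooth homotopy 4-sphere carries a pole immersion"), which derives the named fact
`eliashberg_foldMap_homotopySphere_four` (the upstream debt of item stmt-SmoothPoincare4-14076)
from `H`. Together with `eliashberg_foldMap_homotopySphere_four_of_smoothPoincare4`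
(`…FactSanity.lean`: SPC4 ⇒ fact) this pins the logical position of that proof route:
`H ⇒ SPC4 ⇒ fact` (first arrow mod Gromov), so discharging the fact through `H` would prove the
summit. Eliashberg's theorem (Gromov, PDR §2.1.3 (D)) gives the fact for every homotopy sphere,
exotic or not, by a two-sided fold surgery whose fold IMAGE is an arbitrary immersed 3-sphere;
it does not give `H`. [cite: Gromov1985, §0.3.C] [cite: Gromov1986, §2.1.3 (D) Theorem p. 59] -/
theorem smoothPoincare4_of_poleImmersion (hA : gromov_recognitionR4_relEnd)
    (H : ∀ (M : Type) [TopologicalSpace M] [T2Space M] [SecondCountableTopology M]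
      [ChartedSpace (EuclideanSpace ℝ (Fin 4)) M] [IsManifold (𝓡 4) ∞ M],
      M ≃ₕ Metric.sphere (0 : EuclideanSpace ℝ (Fin 5)) 1 →
      ∃ (q : M) (χ : OpenPartialHomeomorph M (EuclideanSpace ℝ (Fin 4)))
        (g : M → EuclideanSpace ℝ (Fin 4)),
        χ ∈ IsManifold.maximalAtlas (𝓡 4) ∞ M ∧ q ∈ χ.source ∧ χ q = 0 ∧
        (∀ x, x ≠ q → ContMDiffAt (𝓡 4) (𝓡 4) ∞ g x) ∧
        (∀ x, x ≠ q → Injective (mfderiv (𝓡 4) (𝓡 4) g x)) ∧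
        (∀ x ∈ χ.source, x ≠ q → g x = (‖χ x‖ ^ 2)⁻¹ • χ x)) :
    _root_.SmoothPoincare4 := by
  intro M _ _ _ _ _ hM
  obtain ⟨q, χ, g, hχ, hq, hχq, hg, hg', hpole⟩ := H M hM
  exact nonempty_diffeomorph_sphere_of_poleImmersion hA hM hχ hq hχq hg hg' hpole

/-- **Conversely, SPC4 gives pole immersions** (unconditionally): if `M ≅ S⁴` then, by the
tree's proved chart form of Palais' disc theorem (`palais_puncturedSphere_chartForm_holds`), for
any `p ∈ M` there is a diffeomorphism `Φ : M ∖ {p} ≃ₘ ℝ⁴` equal to the inverted recentred chart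
`ι ∘ (e − e p)` on a punctured chart-ball of radius `ε`; then `χ = (e − e p)|_{e⁻¹ B(e p, ε)}`
(a chart of the maximal atlas centred at `p`: a chart translated and restricted) and `g = Φ`
(extended by `0` at `p`) are a pole immersion. So, granted Gromov's theorem, `H ↔ SPC4`.
[cite: Palais1960, Thm. B] -/
theorem poleImmersion_of_smoothPoincare4 (h : _root_.SmoothPoincare4) :
    ∀ (M : Type) [TopologicalSpace M] [T2Space M] [SecondCountableTopology M]
      [ChartedSpace (EuclideanSpace ℝ (Fin 4)) M] [IsManifold (𝓡 4) ∞ M],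
      M ≃ₕ Metric.sphere (0 : EuclideanSpace ℝ (Fin 5)) 1 →
      ∃ (q : M) (χ : OpenPartialHomeomorph M (EuclideanSpace ℝ (Fin 4)))
        (g : M → EuclideanSpace ℝ (Fin 4)),
        χ ∈ IsManifold.maximalAtlas (𝓡 4) ∞ M ∧ q ∈ χ.source ∧ χ q = 0 ∧
        (∀ x, x ≠ q → ContMDiffAt (𝓡 4) (𝓡 4) ∞ g x) ∧
        (∀ x, x ≠ q → Injective (mfderiv (𝓡 4) (𝓡 4) g x)) ∧
        (∀ x ∈ χ.source, x ≠ q → g x = (‖χ x‖ ^ 2)⁻¹ • χ x) := by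
  intro M _ _ _ _ _ hM
  classical
  obtain ⟨Ψ⟩ := h M inferInstance inferInstance hM
  -- a point and Palais' chart-form diffeomorphism of the puncture
  set p : M := Ψ.symm ⟨EuclideanSpace.single 0 1, by simp⟩ with hp
  obtain ⟨Φ, ε, hε, hΦ⟩ := palais_puncturedSphere_chartForm_holds M p ⟨Ψ⟩
  set c : E4 := extChartAt (𝓡 4) p p with hc
  have key : ∀ y : M, extChartAt (𝓡 4) p y = chartAt E4 p y := fun y => by
    simp only [extChartAt_coe, Function.comp_apply, modelWithCornersSelf_coe, id_eq]
  -- the translated, restricted chart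
  set D : OpenPartialHomeomorph E4 E4 :=
    (Homeomorph.addRight (-c)).toOpenPartialHomeomorph.restrOpen (Metric.ball c ε)
      Metric.isOpen_ball with hD
  have hDf : ∀ y, D y = y + -c := fun y => rfl
  have hDs : D.source = univ ∩ Metric.ball c ε := by
    rw [hD, OpenPartialHomeomorph.restrOpen_source, Homeomorph.toOpenPartialHomeomorph_source]
  have hDc : ContDiffOn ℝ ∞ D D.source := by
    have h1 : ContDiff ℝ ∞ fun y : E4 => y + -c := contDiff_id.add contDiff_const
    exact h1.contDiffOn.congr fun y _ => hDf y
  have hDc' : ContDiffOn ℝ ∞ D.symm D.target := by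
    have h1 : ContDiff ℝ ∞ fun y : E4 => y + - -c := contDiff_id.add contDiff_const
    refine h1.contDiffOn.congr fun y _ => ?_
    show (Homeomorph.addRight (-c)).symm y = y + - -c
    rw [Homeomorph.addRight_symm]
    rfl
  set χ : OpenPartialHomeomorph M E4 := chartAt E4 p ≫ₕ D with hχ
  have hχA : χ ∈ IsManifold.maximalAtlas (𝓡 4) ∞ M :=
    trans_mem_maximalAtlas_of_contDiffOn (IsManifold.chart_mem_maximalAtlas p) D hDc hDc'
  have hχs : ∀ x, x ∈ χ.source ↔
      x ∈ (chartAt E4 p).source ∧ extChartAt (𝓡 4) p x ∈ Metric.ball c ε := fun x => by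
    rw [hχ, OpenPartialHomeomorph.trans_source, hDs, key]
    simp
  have hχf : ∀ x, χ x = extChartAt (𝓡 4) p x - c := fun x => by
    rw [key, sub_eq_add_neg]; rfl
  -- the immersion, extended by `0` at `p`
  set g : M → E4 := fun x => if hx : x = p then 0 else Φ ⟨x, mem_punctured.2 hx⟩ with hg
  have hgΦ : (fun y : punctured p => g y.1) = Φ := by
    funext y
    simp only [hg, dif_neg (mem_punctured.1 y.2)]
  have hgs : ∀ x, x ≠ p → ContMDiffAt (𝓡 4) (𝓡 4) ∞ g x := by
    intro x hx
    have h1 : ContMDiffAt (𝓡 4) (𝓡 4) ∞ (fun y : punctured p => g y.1) ⟨x, mem_punctured.2 hx⟩ := by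
      rw [hgΦ]; exact Φ.contMDiff.contMDiffAt
    exact contMDiffAt_subtype_iff.1 h1
  refine ⟨p, χ, g, hχA, (hχs p).2 ⟨mem_chart_source E4 p, Metric.mem_ball_self hε⟩,
    by rw [hχf, hc, sub_self], hgs, ?_, ?_⟩
  · -- injectivity of `dg` off `p`: `dΦ = dg ∘ d(val) = dg`
    intro x hx
    set x' : punctured p := ⟨x, mem_punctured.2 hx⟩ with hx'
    have hn : (∞ : WithTop ℕ∞) ≠ 0 := by simp
    have h1 : HasMFDerivAt (𝓡 4) (𝓡 4) (fun y : punctured p => g y.1) x'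
        ((mfderiv (𝓡 4) (𝓡 4) g x).comp (ContinuousLinearMap.id ℝ E4)) :=
      ((hgs x hx).mdifferentiableAt hn).hasMFDerivAt.comp x'
        (OpenSubmanifold.hasMFDerivAt_subtype_val (I := 𝓡 4) (U := punctured p) x')
    rw [hgΦ] at h1
    have h2 : Injective (mfderiv (𝓡 4) (𝓡 4) Φ x') := by
      have h := (Φ.mfderivToContinuousLinearEquiv hn x').injective
      rw [← ContinuousLinearEquiv.coe_coe, Diffeomorph.mfderivToContinuousLinearEquiv_coe] at h
      exact h
    rw [h1.mfderiv] at h2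
    intro v w hvw
    exact h2 (show ((mfderiv (𝓡 4) (𝓡 4) g x).comp (ContinuousLinearMap.id ℝ E4)) v =
      ((mfderiv (𝓡 4) (𝓡 4) g x).comp (ContinuousLinearMap.id ℝ E4)) w from hvw)
  · -- the pole
    intro x hxχ hx
    obtain ⟨hxs, hxb⟩ := (hχs x).1 hxχ
    have h1 : g x = Φ ⟨x, mem_punctured.2 hx⟩ := by simp only [hg, dif_neg hx]
    rw [h1, hΦ ⟨x, mem_punctured.2 hx⟩ hxs hxb, hχf]
    rfl

/-- **`H ↔ SPC4`, granted Gromov's recognition theorem.** The pole-immersion hypothesis of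
`eliashberg_foldMap_homotopySphere_four_of_poleImmersion` is equivalent to the smooth
4-dimensional Poincaré conjecture modulo `gromov_recognitionR4_relEnd` (`→`:
`smoothPoincare4_of_poleImmersion`; `←`: `poleImmersion_of_smoothPoincare4`, unconditional).
[cite: Gromov1985, §0.3.C] [cite: Palais1960, Thm. B] -/
theorem poleImmersion_iff_smoothPoincare4 (hA : gromov_recognitionR4_relEnd) :
    (∀ (M : Type) [TopologicalSpace M] [T2Space M] [SecondCountableTopology M]
      [ChartedSpace (EuclideanSpace ℝ (Fin 4)) M] [IsManifold (𝓡 4) ∞ M],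
      M ≃ₕ Metric.sphere (0 : EuclideanSpace ℝ (Fin 5)) 1 →
      ∃ (q : M) (χ : OpenPartialHomeomorph M (EuclideanSpace ℝ (Fin 4)))
        (g : M → EuclideanSpace ℝ (Fin 4)),
        χ ∈ IsManifold.maximalAtlas (𝓡 4) ∞ M ∧ q ∈ χ.source ∧ χ q = 0 ∧
        (∀ x, x ≠ q → ContMDiffAt (𝓡 4) (𝓡 4) ∞ g x) ∧
        (∀ x, x ≠ q → Injective (mfderiv (𝓡 4) (𝓡 4) g x)) ∧
        (∀ x ∈ χ.source, x ≠ q → g x = (‖χ x‖ ^ 2)⁻¹ • χ x)) ↔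
    _root_.SmoothPoincare4 :=
  ⟨smoothPoincare4_of_poleImmersion hA, poleImmersion_of_smoothPoincare4⟩

/-- **Summary for the debt `eliashberg_foldMap_homotopySphere_four`.** Granted Gromov's theorem
`hA`, the pole-immersion hypothesis `H` yields BOTH the summit `SmoothPoincare4` (this file) and
the named fact (through `…FactSanity`'s `eliashberg_foldMap_homotopySphere_four_of_smoothPoincare4`,
or directly through the tree's `eliashberg_foldMap_homotopySphere_four_of_poleImmersion`): the
route "discharge the fact via a pole immersion" is exactly as hard as SPC4, whereas the fact
itself is a theorem in print (Eliashberg 1970; Gromov, PDR §2.1.3 (D)) not known to imply SPC4.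
[cite: Gromov1986, §2.1.3 (D) Theorem p. 59] [cite: Gromov1985, §0.3.C] -/
theorem poleImmersion_route_is_spc4_hard (hA : gromov_recognitionR4_relEnd)
    (H : ∀ (M : Type) [TopologicalSpace M] [T2Space M] [SecondCountableTopology M]
      [ChartedSpace (EuclideanSpace ℝ (Fin 4)) M] [IsManifold (𝓡 4) ∞ M],
      M ≃ₕ Metric.sphere (0 : EuclideanSpace ℝ (Fin 5)) 1 →
      ∃ (q : M) (χ : OpenPartialHomeomorph M (EuclideanSpace ℝ (Fin 4)))
        (g : M → EuclideanSpace ℝ (Fin 4)),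
        χ ∈ IsManifold.maximalAtlas (𝓡 4) ∞ M ∧ q ∈ χ.source ∧ χ q = 0 ∧
        (∀ x, x ≠ q → ContMDiffAt (𝓡 4) (𝓡 4) ∞ g x) ∧
        (∀ x, x ≠ q → Injective (mfderiv (𝓡 4) (𝓡 4) g x)) ∧
        (∀ x ∈ χ.source, x ≠ q → g x = (‖χ x‖ ^ 2)⁻¹ • χ x)) :
    _root_.SmoothPoincare4 ∧ eliashberg_foldMap_homotopySphere_four :=
  ⟨smoothPoincare4_of_poleImmersion hA H,
    eliashberg_foldMap_homotopySphere_four_of_smoothPoincare4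
      (smoothPoincare4_of_poleImmersion hA H)⟩

end Pole

end Summit.SmoothPoincare4.SmoothPoincare4.Theorems.FoldedSphereFoldExistence

end
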